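import Mathlib
import Literature.AlgebraicGeometry.Resolution.CobordantBlowupFiltration
import Literature.AlgebraicGeometry.Resolution.CobordantBlowupExtReesBridge
import HarnessLib

/-!
# (H0) of (K-wild-hom): the `t`-GRADING of the cobordant algebra `cobordantAlgebra' u w = S[t⁻¹, uᵢ t^{wᵢ}] ⊆ S[t, t⁻¹]`
# — what «T-homogeneous prime» means in Lean

Route `ResolutionOfSingularities/WeightedInvariant`, door crux `HypersurfaceCentreConstruction` (stmt-ResolutionOfSingularities-19897), P3 rung,
ORDER (o50) of res-L1-w43-plan-1 (registrar DESIGN INPUT 13:46:56Z «HOMOGENEITY REPLACES THE SLICE»); res-type-060 (gen 10), memo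
`plan/tools/res-type-060/o50/K-WILD-HOM.md` §0.  [OURS · L1 W4.3 · helper, counted 0] — plumbing over Mathlib's `AddMonoidAlgebra.grade` and the
tree's coefficientwise extended Rees algebra (`IdealFiltration.extendedRees`, `extReesAlgebra_weightedMonomialIdeal_eq_extendedRees`); nothing here
is a statement of the manuscript under review (Hironaka 2017) or of [Wlodarczyk2022] as printed.  AI proof, weaker than expert review.

* `tPiece S' n` — for ANY subalgebra `S' ⊆ A[t, t⁻¹]`: the trace `S' ∩ A·tⁿ` of the `n`-th Laurent degree (an `A`-submodule of `S'`);
  `gradedMonoid_tPiece`, `iSupIndep_tPiece`; if `S'` contains the monomials of its elements (`single n (p n) ∈ S'`) then the traces span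
  (`iSup_tPiece_eq_top`) and **`S'` is a graded ring** (`nonempty_gradedRing_tPiece`) — the pattern of `DatumToEmbedded.AtlasAmbient.subalgebraPiece`
  (…DatumToEmbeddedAtlasAmbientGraded) with `A`-submodules and Mathlib's `AddMonoidAlgebra.grade A` as the ambient grading.
* `IdealFiltration.single_coeff_mem_extendedRees` — a coefficientwise extended Rees algebra contains the monomials of its elements; hence
  **`nonempty_gradedRing_tGrading`**: the door's carrier `cobordantAlgebra' u w = extReesAlgebra (weightedMonomialIdeal u w)` IS `t`-GRADED by
  `tGrading u w := tPiece _`, and «`𝔫` is T-homogeneous» := `𝔫.IsHomogeneous (tGrading u w)` (Mathlib `Ideal.IsHomogeneous`, given the instance).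
* `tInv_mem_tGrading` (`t⁻¹` has degree `−1`), `C_mul_T_mem_tGrading` (`a·tⁿ` has degree `n`), `isHomogeneous_vertexIdeal` (the vertex ideal
  `(a tⁿ : n ≥ 1, a ∈ Jₙ)` is homogeneous).
Consumers: (H1) `KWildHom.exists_homogeneous_regularParameters` (…HomogeneousRegularParameters) at a homogeneous prime of `cobordantAlgebra'`; the
restricted (drop) conjunct `WeightedDropHom` of the memo §3.
-/

noncomputable section

set_option linter.dupNamespace false -- mandated namespace of this single-conjunct summit

open scoped LaurentPolynomial
open DirectSum Literature.AlgebraicGeometry.Resolution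

namespace Summit.ResolutionOfSingularities.ResolutionOfSingularities.Theorems

namespace KWildHom

/-! ## §1 Traces of the Laurent grading on a subalgebra -/

section Pieces

variable {A : Type*} [CommRing A] (S' : Subalgebra A A[T;T⁻¹])

/-- The `n`-th `t`-DEGREE PIECE of a subalgebra of `A[t, t⁻¹]`: its elements whose underlying Laurent polynomial is a monomial of degree `n`
(trace of Mathlib's `AddMonoidAlgebra.grade A n`). [OURS · L1 W4.3] -/
def tPiece (n : ℤ) : Submodule A S' :=
  (AddMonoidAlgebra.grade A n).comap S'.val.toLinearMap

variable {S'} in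
/-- Membership in a degree piece. [folklore] -/
theorem mem_tPiece_iff {n : ℤ} {x : S'} : x ∈ tPiece S' n ↔ (x : A[T;T⁻¹]) ∈ AddMonoidAlgebra.grade A n :=
  Iff.rfl

/-- The degree pieces form a graded monoid. [folklore] -/
theorem gradedMonoid_tPiece : SetLike.GradedMonoid (tPiece S') where
  one_mem := by
    rw [mem_tPiece_iff, OneMemClass.coe_one]
    exact SetLike.one_mem_graded (AddMonoidAlgebra.grade A)
  mul_mem n n' x y hx hy := by
    rw [mem_tPiece_iff, MulMemClass.coe_mul]
    exact SetLike.mul_mem_graded hx hy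

/-- The degree pieces are independent. [folklore] -/
theorem iSupIndep_tPiece : iSupIndep (tPiece S') := by
  classical
  rw [iSupIndep_iff_finsetSum_eq_zero_imp_eq_zero]
  intro s v hv hsum n hn
  have hsum' : ∑ i ∈ s, (v i : A[T;T⁻¹]) = 0 := by
    rw [← AddSubmonoidClass.coe_finsetSum, hsum, ZeroMemClass.coe_zero]
  have h := (iSupIndep_iff_finsetSum_eq_zero_imp_eq_zero (AddMonoidAlgebra.grade A (M := ℤ))).1
    (Decomposition.isInternal (AddMonoidAlgebra.grade A (M := ℤ))).submodule_iSupIndep s (fun i => (v i : A[T;T⁻¹])) hv hsum' n hn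
  exact_mod_cast h

variable (hS : ∀ p : A[T;T⁻¹], p ∈ S' → ∀ n : ℤ, AddMonoidAlgebra.single n (p.coeff n) ∈ S')
include hS

/-- If `S'` contains the monomials of its elements, the degree pieces span. [folklore] -/
theorem iSup_tPiece_eq_top : ⨆ n, tPiece S' n = ⊤ := by
  classical
  rw [eq_top_iff]
  rintro x -
  have hx : x = ∑ n ∈ (x : A[T;T⁻¹]).coeff.support,
      (⟨AddMonoidAlgebra.single n ((x : A[T;T⁻¹]).coeff n), hS x x.2 n⟩ : S') := by
    apply Subtype.ext
    rw [AddSubmonoidClass.coe_finsetSum]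
    exact (AddMonoidAlgebra.sum_coeff_single (x : A[T;T⁻¹])).symm
  rw [hx]
  exact Submodule.sum_mem _ fun n _ => Submodule.mem_iSup_of_mem n
    (mem_tPiece_iff.2 (AddMonoidAlgebra.single_mem_grade n _))

/-- **A subalgebra of `A[t, t⁻¹]` containing the monomials of its elements is `t`-GRADED** by the degree pieces. [OURS · L1 W4.3] -/
theorem nonempty_gradedRing_tPiece : Nonempty (GradedRing (tPiece S')) :=
  have hint : DirectSum.IsInternal (tPiece S') :=
    (DirectSum.isInternal_submodule_iff_iSupIndep_and_iSup_eq_top _).2 ⟨iSupIndep_tPiece S', iSup_tPiece_eq_top S' hS⟩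
  ⟨{ (gradedMonoid_tPiece S') with toDecomposition := hint.chooseDecomposition }⟩

end Pieces

/-! ## §2 The coefficientwise extended Rees algebra contains its monomials; the door's carrier is `t`-graded -/

section Rees

variable {A : Type*} [CommRing A]

/-- A coefficientwise extended Rees algebra contains the monomials of its elements. [folklore] -/
theorem single_coeff_mem_extendedRees (F : IdealFiltration A) {p : A[T;T⁻¹]} (hp : p ∈ F.extendedRees) (n : ℤ) :
    AddMonoidAlgebra.single n (p.coeff n) ∈ F.extendedRees :=
  (F.single_mem_extendedRees_iff).mpr (hp n)

variable {m : ℕ} (u : Fin m → A) (w : Fin m → ℕ)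

/-- `extReesAlgebra (weightedMonomialIdeal u w)` (the carrier of `cobordantAlgebra' u w`) contains the monomials of its elements.
[OURS · L1 W4.3] -/
theorem single_coeff_mem_extReesAlgebra {p : A[T;T⁻¹]} (hp : p ∈ extReesAlgebra (weightedMonomialIdeal u w)) (n : ℤ) :
    AddMonoidAlgebra.single n (p.coeff n) ∈ extReesAlgebra (weightedMonomialIdeal u w) := by
  rw [extReesAlgebra_weightedMonomialIdeal_eq_extendedRees] at hp ⊢
  exact single_coeff_mem_extendedRees _ hp n

/-- **THE `t`-GRADING OF THE COBORDANT ALGEBRA** `S[t⁻¹, uᵢ t^{wᵢ}] = extReesAlgebra (weightedMonomialIdeal u w)` (= `cobordantAlgebra' u w`):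
the degree pieces `tPiece`. [OURS · L1 W4.3] -/
abbrev tGrading : ℤ → Submodule A (extReesAlgebra (weightedMonomialIdeal u w)) :=
  tPiece (extReesAlgebra (weightedMonomialIdeal u w))

/-- **The cobordant algebra is `t`-graded.** [OURS · L1 W4.3] -/
theorem nonempty_gradedRing_tGrading : Nonempty (GradedRing (tGrading u w)) :=
  nonempty_gradedRing_tPiece _ fun _ hp n => single_coeff_mem_extReesAlgebra u w hp n

/-- `t⁻¹` is homogeneous of degree `−1`. [OURS · L1 W4.3] -/
theorem tInv_mem_tGrading : extReesAlgebra.tInv (weightedMonomialIdeal u w) ∈ tGrading u w (-1) := by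
  rw [mem_tPiece_iff, extReesAlgebra.coe_tInv, ← mul_one (LaurentPolynomial.T (-1) : A[T;T⁻¹]), mul_comm,
    ← map_one (LaurentPolynomial.C : A →+* A[T;T⁻¹]), ← LaurentPolynomial.single_eq_C_mul_T]
  exact AddMonoidAlgebra.single_mem_grade _ _

/-- A generator `a·tⁿ` is homogeneous of degree `n`. [OURS · L1 W4.3] -/
theorem C_mul_T_mem_tGrading {n : ℕ} (hn : 0 < n) {a : A} (ha : a ∈ weightedMonomialIdeal u w n) :
    (⟨LaurentPolynomial.C a * LaurentPolynomial.T (n : ℤ), extReesAlgebra.C_mul_T_mem _ hn ha⟩ :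
      extReesAlgebra (weightedMonomialIdeal u w)) ∈ tGrading u w n := by
  rw [mem_tPiece_iff, Subtype.coe_mk, ← LaurentPolynomial.single_eq_C_mul_T]
  exact AddMonoidAlgebra.single_mem_grade _ _

/-- The vertex ideal `(a tⁿ : n ≥ 1, a ∈ Jₙ)` is homogeneous for the `t`-grading. [OURS · L1 W4.3] -/
theorem isHomogeneous_vertexIdeal [GradedRing (tGrading u w)] :
    (extReesAlgebra.vertexIdeal (weightedMonomialIdeal u w)).IsHomogeneous (tGrading u w) := by
  unfold extReesAlgebra.vertexIdeal
  refine Ideal.homogeneous_span _ _ fun x hx => ?_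
  obtain ⟨n, hn, a, ha, hx⟩ := hx
  refine ⟨(n : ℤ), ?_⟩
  rw [mem_tPiece_iff, hx, ← LaurentPolynomial.single_eq_C_mul_T]
  exact AddMonoidAlgebra.single_mem_grade _ _

end Rees

end KWildHom

end Summit.ResolutionOfSingularities.ResolutionOfSingularities.Theorems

end
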